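import Summits.QuantumFields.YangMills.Theses.InfiniteVolumeContinuum
import Summits.QuantumFields.YangMills.Theorems.InfiniteVolumeContinuumIVEuclideanInvarianceSymmetric
import Summits.QuantumFields.YangMills.Theorems.InfiniteVolumeContinuumIVEuclideanInvarianceDensity
import Summits.QuantumFields.YangMills.Theorems.InfiniteVolumeContinuumIVEuclideanInvarianceGerm
import Summits.QuantumFields.YangMills.Theorems.InfiniteVolumeContinuumIVEuclideanInvarianceSigned
import Summits.QuantumFields.YangMills.Theorems.LangevinControlUVOSLegsAtWeakCouplingCStubLocality
import Summits.QuantumFields.YangMills.Theorems.LangevinControlUVOSLegsAtWeakCouplingCSketchGermRot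
import HarnessLib

/-!
# Route `InfiniteVolumeContinuum`: support `IVEuclideanInvariance` (stmt-QuantumFields-19933) — CLOSING FILE

Lead seat `ym-infvol-p1` (R136 (i)).  HONEST FRAMING: existence half only, conditional on Track A's `BalabanLadder.UV`
(the route's cruxes `UVCond`/`SeamRec`/`Rot` are the spine's legs BY NAME and stay open); `MomentBounds6` and
`LatticeRotWard` enter as HYPOTHESES of the item; nothing about Yang–Mills is asserted unconditionally; not a gap, not Clay.

`IVEuclideanInvariance_proof : Theses.InfiniteVolumeContinuum.IVEuclideanInvariance` — full Euclidean invariance (E1) of the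
infinite-volume-first continuum data, assembled BY NAME from the registered skeleton's pieces:
W0 `isSymmetric_of_ivData` (E3 from the DATA clause), W1 `stub_ivSigned` (hyperoctahedral invariance, seat p3),
W2 `stub_ivDensity` (bounded densities off the diagonal from `MomentBounds6`), W3 `stub_ivGerm` (det-1 planar germ
invariance from `LatticeRotWard` through seat p2's torus junction), then the spine's landed E1 chain: `Sketch.stub_locality`
(E1 is local at the origin: germ ⇒ global planar invariance, given translations, E3, E0′, `RPPos`, signed permutations,
densities) and `Sketch.isEuclideanInvariant_of_planarRot` (Givens generation of `SO(4)` + signed permutations + translations).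

References: K. Osterwalder, R. Schrader, CMP 31 (1973), CMP 42 (1975); C. King, CMP 103 (1986).
-/

set_option autoImplicit false

noncomputable section

open MeasureTheory Filter Topology
open scoped BigOperators SchwartzMap
open Literature.MathematicalPhysics.QuantumFieldTheory hiding ZdEdge
open Literature.MathematicalPhysics.QuantumLattice
open Literature.MathematicalPhysics.AQFT
open Summit.QuantumFields.YangMills.Cruxes.OSLegsFromFemtoAndGap.DlrCollarTransfer
open Summit.QuantumFields.YangMills.Cruxes.OSLegsAtWeakCouplingC.Sketch
  (IsPlanar01 OffDiagDensity Invariant GermInvariant IsSignedPerm stub_locality isEuclideanInvariant_of_planarRot)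
open Summit.QuantumFields.YangMills.Cruxes.OSLegsAtWeakCouplingC.Y2Bridge (LatticeRotWard)

namespace Summit.QuantumFields.YangMills.Theorems.InfiniteVolume.E1

/-! ## The composition: the item BY NAME -/

/-- **`IVEuclideanInvariance` from W0–W3 and the spine's landed E1 chain** (`stub_locality`: a planar isometry fixing
`S₁` on the germ fixes it on `⁰𝒮`, given translations, E3, E0′, `RPPos`, signed permutations and bounded densities;
`isEuclideanInvariant_of_planarRot`: signed permutations + det-1 planar invariance + translations ⇒ E1). -/
theorem IVEuclideanInvariance_proof : Summit.QuantumFields.YangMills.Theses.InfiniteVolumeContinuum.IVEuclideanInvariance := by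
  intro G _ _ _ _ _ _ r a β μ S₁ T hapos ha0 hMB hROT hdata hLG htrans hRP
  obtain ⟨hβ, hμ, h0, h1, hS, hT⟩ := hdata
  have hE3 : S₁.toLabelled.IsSymmetric := isSymmetric_of_ivData r a β μ S₁ T h0 h1 hS hT
  have hsigned : ∀ R : EuclideanSpace ℝ (Fin 4) ≃ₗᵢ[ℝ] EuclideanSpace ℝ (Fin 4), IsSignedPerm R → Invariant S₁ R :=
    stub_ivSigned r a β μ S₁ T hapos hμ h0 h1 hS hT
  have hdens : OffDiagDensity S₁ := stub_ivDensity r a β μ S₁ T hapos ha0 hMB hβ hμ h0 h1 hS hT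
  obtain ⟨r₁, hr₁, hgerm⟩ := stub_ivGerm r a β μ S₁ T hapos ha0 hMB hROT hβ hμ h1 hS hT hdens
  have hplanar : ∀ R : EuclideanSpace ℝ (Fin 4) ≃ₗᵢ[ℝ] EuclideanSpace ℝ (Fin 4), LinearMap.det (R.toLinearEquiv : EuclideanSpace ℝ (Fin 4) →ₗ[ℝ] EuclideanSpace ℝ (Fin 4)) = 1 → IsPlanar01 R →
      Invariant S₁ R := fun R hdet hR =>
    stub_locality S₁ h0 htrans hE3 hLG hRP hsigned hdens R hR r₁ hr₁ (hgerm R hdet hR)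
  exact isEuclideanInvariant_of_planarRot S₁ htrans hsigned hplanar

end Summit.QuantumFields.YangMills.Theorems.InfiniteVolume.E1

end
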